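import Summits.HodgeConjecture.CorCM.CycleClassFacts
import Mathlib.LinearAlgebra.BilinearForm.Properties
import Mathlib.LinearAlgebra.BilinearForm.TensorProduct
import Mathlib.LinearAlgebra.Contraction
import Mathlib.LinearAlgebra.Dual.Lemmas
import HarnessLib

/-!
# COR-CM model layer, row M22 `Fact_algDuality`, clause (i), input K-b′: the Künneth class of the
# Casimir element of a Riemann-type pairing on `H¹(X)` is a rational `(1,1)`-class on `X × X`, hence algebraic

Cell `pub-hodgecm2` (COR-CM = stage 2 of the Hodge ladder; HOME `run/shared/lean/pub/pub-hodgecm2/`), seat `b30`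
(M22 reserve).  Row M22 of `BINDER-OWNERS.md` asks for the stage-1 fact `Fact_algDuality` (port
`CorCM/Geometry/Facts.lean`: an algebraic, degree-intertwining `ℚ`-linear bijection `D : H^{2d-4}(P) → H⁴(P)` for the
corner product `P`) on the Picard–CM model.  The lead's plan (INBOX 2026-08-20T18:41:53Z, F-1 option (ii)) proves
clause (i) "`D` maps algebraic classes to algebraic classes" by exhibiting `D` as the correspondence of the rational
algebraic class `± ℓ⁴/4!` on `P × P`, where `ℓ` is the Poincaré (Mukai–Beauville) class; its input **K-b** is
"`ℓ ∈ Alg¹(P × P)`", classically `ℓ = (1 × φ_θ)^* c₁(𝒫) = m^*θ − pr₁^*θ − pr₂^*θ` for a polarisation `θ`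
(the see-saw class; Lange 2023 §1.4.4, §6.1.1; Beauville, LNM 1016 (1983) Prop. 1).

THIS FILE proves K-b in a form that needs neither the group law `m : P × P → P` nor the Mumford bundle: for ANY smooth
projective `X/ℂ` and ANY nondegenerate bilinear form `E` on `H¹(X(ℂ); ℚ)` satisfying the Riemann condition
`E_ℂ(F¹H¹, F¹H¹) = 0` (for an abelian variety: `E` is the inverse of a Riemann form, i.e. its class is of type `(1,1)`),
the Künneth class of the Casimir element of `E`,

  `ℓ_E := Σ_i fst^* u_i ∪ snd^* v_i ∈ H²((X × X)(ℂ); ℚ)`   (`v` any basis of `H¹(X(ℂ); ℚ)`, `u` its `E`-dual basis,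
  `E (u_i) (v_j) = δ_{ij}`; the sum does not depend on `v`, `sum_dualBasis_eq`),

is a rational Hodge class (`casimirClass_mem_hodgeClasses`: `1 ⊗ ℓ_E ∈ F¹H²(X × X)`), hence a rational algebraic
class by Lefschetz (1,1) (`casimirClass_mem_ratAlgebraicClasses`, through the tree's `lefschetzOneOne_rational_holds`
as packaged in `Model.hodgeClasses_one_le_ratAlgebraicClasses`, `CorCM/CycleClassFacts.lean`).  For `X = P` and
`E` the (Rosati-balanced) Riemann form this is the classical `ℓ`, since under Künneth `H¹ ⊗ H¹ ⊂ H²(P × P)` the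
class `(1 × φ_θ)^* c₁(𝒫) = m^*θ − pr₁^*θ − pr₂^*θ` is the mixed tensor `Σ_i e_i ⊗ f_i` of Lange's Lemma 6.1.8, i.e.
the Casimir element of the form `E` dual to `θ`.

PROOF (`sum_dualBasis_mem`, pure linear algebra over a field): the Casimir sum `Σ_i c(u_i, v_i)` of a bilinear map
`c` is basis-independent (it is the image of `id ∈ End W ≅ W^∨ ⊗ W`); compute it in a `ℂ`-basis of
`W = H¹(X; ℂ)` adapted to `P' = F¹H¹`: for `v_k ∈ F¹` the term `fst^*u_k ∪ snd^*v_k` lies in `F⁰ · F¹ ⊆ F¹`; for the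
other `v_k` the dual vector `u_k` is `E`-orthogonal to `F¹`, and the left `E`-orthogonal of `F¹` IS `F¹` because
`E(F¹, F¹) = 0` and `dim F¹ = ½ dim H¹` (`F¹ ⊕ conj F¹ = H¹_ℂ`, `finrank_F_one_add`), so the term lies in
`F¹ · F⁰ ⊆ F¹`.  Inputs from the tree: `BettiUniverse.pull_hodge`, `BettiUniverse.cup2_hodge` (both over `hI`),
`HodgeModel.ratF_of_nonpos`, the weight-one axiom `HodgeStructure.isCompl_F_complexConj`.

NOT here (other inputs of row M22, other seats): the exterior identity `Σ_{|I|=4} fst^*u_I ∪ snd^*v_I = ± ℓ_E⁴/4!`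
(K-b″), the projection formula `snd_!(fst^*z ∪ fst^*x ∪ snd^*y) = r · tr(z ∪ x) · y` (K-c), the operator
`D = (⋀⁴E)♯⁻¹ ∘ PD♯` with clauses (o), (ii) (K-a, model-1), and the Rosati-balanced Riemann form of the coded CM
realisations (R2).  No statement of the summit, of a route, or of the interface packet is touched; no named fact is
introduced — every declaration is a theorem of Mathlib and of the tree's existing theorems.

References: H. Lange, *Abelian Varieties over the Complex Numbers* (Grundlehren, 2023) — held text
`book:lange1992-complex-abelian-varieties` — §1.4.4 Thm. 1.4.10 (the hermitian form `c₁(𝒫) = H((v₁,l₁),(v₂,l₂)) =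
conj(l₂(v₁)) + l₁(v₂)`), §6.1.1 Lemma 6.1.7 (`c₁(𝒫_X) ∈ H¹(X) ⊗ H¹(X̂)`) and **Lemma 6.1.8 (`c₁(𝒫_X) = Σ_i e_i ⊗ f_i`,
`f_i` the image of the dual basis — held chunk p0292)**, §6.2.4 Prop. 6.2.20 (`F_H|_{H^p} = ± α_p`,
`e^{cl(𝒫)} = Σ_J ± e_J ⊗ f_J` — held chunk p0310); A. Beauville, *Quelques remarques sur la transformation de Fourier
dans l'anneau de Chow d'une variété abélienne*, LNM 1016 (1983) 238–260, Prop. 1; D. Lieberman, *Numerical and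
homological equivalence of algebraic cycles on Hodge manifolds*, Amer. J. Math. 90 (1968) 366–374; C. Voisin, *Hodge
Theory and Complex Algebraic Geometry I* (2002), §7.1.1, §7.3.2, Thm. 11.30 (Lefschetz (1,1)), Thm. 11.38 (Künneth).
-/

noncomputable section

open scoped TensorProduct
open Module

namespace Summit.HodgeConjecture.CorCM.Model

/-! ### §1 Linear algebra: the Casimir element of a nondegenerate bilinear form -/

section Casimir

variable {K W M : Type*} [Field K] [AddCommGroup W] [Module K W] [FiniteDimensional K W]
  [AddCommGroup M] [Module K M]

omit [FiniteDimensional K W] in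
/-- The element `Σ_i v^i ⊗ v_i ∈ W^∨ ⊗ W` of a finite basis `v` maps to the identity under
`W^∨ ⊗ W → End W`. -/
theorem dualTensorHom_sum_coord_tmul {ι : Type*} [Fintype ι] (v : Basis ι K W) :
    dualTensorHom K W W (∑ i, v.coord i ⊗ₜ[K] v i) = LinearMap.id := by
  ext w
  simp only [map_sum, LinearMap.coe_sum, Finset.sum_apply, dualTensorHom_apply,
    Basis.coord_apply, LinearMap.id_coe, id_eq, Basis.sum_repr]

omit [FiniteDimensional K W] in
/-- The element `Σ_i v^i ⊗ v_i ∈ W^∨ ⊗ W` does not depend on the finite basis `v`. -/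
theorem sum_coord_tmul_eq {ι κ : Type*} [DecidableEq ι] [Fintype ι] [Fintype κ] (v : Basis ι K W)
    (v₂ : Basis κ K W) :
    ∑ i, v.coord i ⊗ₜ[K] v i = ∑ k, v₂.coord k ⊗ₜ[K] v₂ k := by
  apply (dualTensorHomEquivOfBasis (N := W) v).injective
  rw [dualTensorHomEquivOfBasis_apply, dualTensorHomEquivOfBasis_apply,
    dualTensorHom_sum_coord_tmul, dualTensorHom_sum_coord_tmul]

/-- The `E`-dual basis vector `u_i` of `v` (`E (u_i) (v_j) = δ_{ij}`) is `E♯⁻¹` of the coordinate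
form `v^i`. -/
theorem dualBasis_apply_eq (E : LinearMap.BilinForm K W) (hE : E.Nondegenerate) {ι : Type*} [DecidableEq ι]
    [Fintype ι] (v : Basis ι K W) (i : ι) :
    E.dualBasis hE v i = (E.toDual hE).symm (v.coord i) := by
  rw [LinearMap.BilinForm.dualBasis, Basis.map_apply, Basis.coe_dualBasis]

/-- **Basis-independence of the Casimir sum**: for a bilinear map `c` on `W` and a nondegenerate
bilinear form `E`, `Σ_i c (u_i) (v_i)` — `(u_i)` the `E`-dual basis of the basis `(v_i)` — is
the same for all finite bases `v`. -/
theorem sum_dualBasis_eq (E : LinearMap.BilinForm K W) (hE : E.Nondegenerate) (c : W →ₗ[K] W →ₗ[K] M)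
    {ι κ : Type*} [DecidableEq ι] [Fintype ι]
    [DecidableEq κ] [Fintype κ] (v : Basis ι K W) (v₂ : Basis κ K W) :
    ∑ i, c (E.dualBasis hE v i) (v i) = ∑ k, c (E.dualBasis hE v₂ k) (v₂ k) := by
  let Ψ : Module.Dual K W ⊗[K] W →ₗ[K] M :=
    TensorProduct.lift (c ∘ₗ (E.toDual hE).symm.toLinearMap)
  have hΨ : ∀ (f : Module.Dual K W) (w : W), Ψ (f ⊗ₜ w) = c ((E.toDual hE).symm f) w :=
    fun f w ↦ TensorProduct.lift.tmul _ _
  calc ∑ i, c (E.dualBasis hE v i) (v i) = Ψ (∑ i, v.coord i ⊗ₜ[K] v i) := by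
        rw [map_sum]; exact Finset.sum_congr rfl fun i _ ↦ by rw [hΨ, dualBasis_apply_eq E hE]
    _ = Ψ (∑ k, v₂.coord k ⊗ₜ[K] v₂ k) := by rw [sum_coord_tmul_eq v v₂]
    _ = ∑ k, c (E.dualBasis hE v₂ k) (v₂ k) := by
        rw [map_sum]; exact Finset.sum_congr rfl fun k _ ↦ by rw [hΨ, dualBasis_apply_eq E hE]

/-- The left `E`-orthogonal `{x | E x y = 0 ∀ y ∈ P'}` of a subspace `P'` has dimension
`dim W - dim P'` for `E` nondegenerate. -/
theorem finrank_leftOrthogonal (E : LinearMap.BilinForm K W) (hE : E.Nondegenerate) (P' : Submodule K W) :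
    finrank K (P'.dualAnnihilator.comap (E.toDual hE : W →ₗ[K] Module.Dual K W)) + finrank K P' =
      finrank K W := by
  rw [Submodule.comap_equiv_eq_map_symm, LinearEquiv.finrank_map_eq, add_comm,
    Subspace.finrank_add_finrank_dualAnnihilator_eq]

/-- **The Casimir lemma.** Let `E` be a nondegenerate bilinear form on `W`, `P, P' ≤ W` with
`E(P, P') = 0` and `dim W ≤ dim P + dim P'`, and `c` a bilinear map with `c(P, W) ⊆ N`,
`c(W, P') ⊆ N`. Then the Casimir sum `Σ_i c (u_i) (v_i)` (`v` any finite basis, `u` its `E`-dual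
basis) lies in `N`: computed in a basis adapted to `P'`, every dual vector of a basis vector outside
`P'` lies in the left orthogonal of `P'`, which is `P` by the dimension count. -/
theorem sum_dualBasis_mem (E : LinearMap.BilinForm K W) (hE : E.Nondegenerate) (P P' : Submodule K W)
    (h0 : ∀ x ∈ P, ∀ y ∈ P', E x y = 0)
    (hdim : finrank K W ≤ finrank K P + finrank K P') (c : W →ₗ[K] W →ₗ[K] M) (N : Submodule K M)
    (hP : ∀ x ∈ P, ∀ y, c x y ∈ N) (hP' : ∀ x, ∀ y ∈ P', c x y ∈ N)
    {ι : Type*} [DecidableEq ι] [Fintype ι] (v : Basis ι K W) :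
    ∑ i, c (E.dualBasis hE v i) (v i) ∈ N := by
  classical
  obtain ⟨Q, hQ⟩ := P'.exists_isCompl
  let bP := Module.finBasis K P'
  let bQ := Module.finBasis K Q
  let β : Basis (Fin (finrank K P') ⊕ Fin (finrank K Q)) K W :=
    (bP.prod bQ).map (Submodule.prodEquivOfIsCompl P' Q hQ)
  rw [sum_dualBasis_eq E hE c v β]
  -- the left orthogonal of `P'` is `P`
  set L : Submodule K W := P'.dualAnnihilator.comap (E.toDual hE : W →ₗ[K] Module.Dual K W) with hL
  have hPL : P ≤ L := fun x hx ↦ by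
    rw [hL, Submodule.mem_comap, Submodule.mem_dualAnnihilator]
    intro y hy
    exact h0 x hx y hy
  have hLP : L = P := by
    refine (Submodule.eq_of_le_of_finrank_le hPL ?_).symm
    have : finrank K L + finrank K P' = finrank K W := finrank_leftOrthogonal E hE P'
    omega
  refine Submodule.sum_mem _ fun k _ ↦ ?_
  rcases k with i | j
  · -- `β (inl i) ∈ P'`
    refine hP' _ _ ?_
    rw [Basis.map_apply, Basis.prod_apply, Sum.elim_inl, Function.comp_apply,
      Submodule.coe_prodEquivOfIsCompl', LinearMap.inl_apply]
    simp only [Submodule.coe_zero, add_zero, SetLike.coe_mem]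
  · -- the dual vector of `β (inr j) ∈ Q` lies in the left orthogonal `L = P`
    refine hP _ ?_ _
    rw [← hLP, hL, Submodule.mem_comap, Submodule.mem_dualAnnihilator]
    intro y hy
    rw [LinearEquiv.coe_coe, LinearMap.BilinForm.toDual_def, dualBasis_apply_eq E hE,
      LinearMap.BilinForm.apply_toDual_symm_apply, Basis.coord_apply, Basis.map_repr,
      LinearEquiv.trans_apply, Basis.prod_repr_inr]
    have : (Submodule.prodEquivOfIsCompl P' Q hQ).symm y = ((⟨y, hy⟩ : P'), 0) :=
      Submodule.prodEquivOfIsCompl_symm_apply_left P' Q hQ ⟨y, hy⟩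
    rw [this, map_zero, Finsupp.zero_apply]

end Casimir

/-! ### §2 Base change of a nondegenerate form to `ℂ`; `dim F¹ = ½ dim H¹` in weight one -/

section BaseChange

variable {V : Type*} [AddCommGroup V] [Module ℚ V]

/-- The `ℂ`-base change of a nondegenerate bilinear form on a finite-dimensional `ℚ`-space is
nondegenerate (test against the base-changed dual bases). -/
theorem nondegenerate_baseChange [FiniteDimensional ℚ V] (E : LinearMap.BilinForm ℚ V)
    (hE : E.Nondegenerate) : (E.baseChange ℂ).Nondegenerate := by
  classical
  let v := Module.finBasis ℚ V
  let vC : Basis (Fin (finrank ℚ V)) ℂ (ℂ ⊗[ℚ] V) := Algebra.TensorProduct.basis ℂ v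
  have hvC : ∀ i, vC i = 1 ⊗ₜ v i := Algebra.TensorProduct.basis_apply v
  -- left duals `E (u i) (v j) = δ` and right duals `E (v j) (u' i) = δ`
  let u := E.dualBasis hE v
  let u' := E.flip.dualBasis hE.flip v
  have hu : ∀ i j, E (u i) (v j) = if j = i then 1 else 0 := LinearMap.BilinForm.apply_dualBasis_left hE v
  have hu' : ∀ i j, E (v j) (u' i) = if j = i then 1 else 0 := fun i j ↦
    LinearMap.BilinForm.apply_dualBasis_left hE.flip v i j
  refine ⟨fun x hx ↦ ?_, fun y hy ↦ ?_⟩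
  · rw [← vC.sum_repr x]
    refine Finset.sum_eq_zero fun j _ ↦ ?_
    have h := hx (1 ⊗ₜ u' j)
    rw [← vC.sum_repr x, LinearMap.map_sum₂] at h
    simp only [LinearMap.map_smul₂, hvC, LinearMap.BilinForm.baseChange_tmul, hu', mul_one,
      ite_smul, one_smul, zero_smul, smul_eq_mul, mul_ite, mul_one, mul_zero,
      Finset.sum_ite_eq', Finset.mem_univ, if_true] at h
    rw [h, zero_smul]
  · rw [← vC.sum_repr y]
    refine Finset.sum_eq_zero fun j _ ↦ ?_
    have h := hy (1 ⊗ₜ u j)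
    rw [← vC.sum_repr y, map_sum] at h
    simp only [map_smul, hvC, LinearMap.BilinForm.baseChange_tmul, hu, mul_one,
      ite_smul, one_smul, zero_smul, smul_eq_mul, mul_ite, mul_one, mul_zero,
      Finset.sum_ite_eq', Finset.mem_univ, if_true] at h
    rw [h, zero_smul]

open Literature.AlgebraicGeometry.Motives.HodgeStructure in
/-- `dim conj W' = dim W'` for a `ℂ`-subspace `W'` of a complexification: complex conjugation
`conj ⊗ id` restricts to a conjugate-linear bijection `W' ≃ conj W'`, and the rank is invariant under
semilinear bijections over a ring automorphism (as in the tree's `HodgeStructure.hodgeNumber_symm_holds`). -/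
theorem finrank_complexConj (W' : Submodule ℂ (ℂ ⊗[ℚ] V)) :
    finrank ℂ (complexConj W') = finrank ℂ W' := by
  let e : W' ≃+ complexConj W' :=
    { toFun := fun x ↦ ⟨conj x.1, by rw [mem_complexConj, conj_conj]; exact x.2⟩
      invFun := fun x ↦ ⟨conj x.1, x.2⟩
      left_inv := fun x ↦ by ext; simp
      right_inv := fun x ↦ by ext; simp
      map_add' := fun x y ↦ by ext; simp [map_add] }
  unfold Module.finrank
  rw [rank_eq_of_equiv_equiv (starRingEnd ℂ) e
    (Function.Involutive.bijective fun c => starRingEnd_self_apply c)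
    (fun c x => by ext; simp [e, conj_smul])]

open Literature.AlgebraicGeometry.Motives in
/-- **`2 dim F¹ = dim V_ℂ` for a Hodge structure of weight one** (`F¹ ⊕ conj F¹ = V_ℂ`). -/
theorem finrank_F_one_add [FiniteDimensional ℚ V] (H : HodgeStructure V 1) :
    finrank ℂ (H.F 1) + finrank ℂ (H.F 1) = finrank ℂ (ℂ ⊗[ℚ] V) := by
  have h := H.isCompl_F_complexConj 1 1 (by norm_num)
  rw [← Submodule.finrank_add_eq_of_isCompl h, finrank_complexConj]

end BaseChange

/-! ### §3 The Casimir class on `X × X` is a rational `(1,1)`-class, hence algebraic -/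

section Hodge

open CategoryTheory MonoidalCategory
open Literature.AlgebraicGeometry.Motives (SchemeOver IsSmoothProjective bettiCohomology HodgeStructure)
open Literature.AlgebraicGeometry.Motives.HodgeStructure (ofRat)
open Literature.AlgebraicGeometry.HodgeTheory
open Literature.NumberTheory.Automorphic.PicardCM (ratAlgebraicClasses)

variable {n : ℕ} {X : SchemeOver ℂ}

/-- Complexification commutes with `fst^* a ∪ snd^* b`:
`(f^* ⊗ ℂ)(1 ⊗ a) ∪_ℂ (g^* ⊗ ℂ)(1 ⊗ b) = 1 ⊗ (f^* a ∪ g^* b)`. -/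
theorem baseChange_cup_pull_tmul {Y : SchemeOver ℂ} (f g : Y ⟶ X) (a b : bettiCohomology X 1) :
    LinearMap.BilinMap.baseChange ℂ (BettiUniverse.cup Y 1 1)
        ((BettiUniverse.pull f 1).baseChange ℂ ((1 : ℂ) ⊗ₜ[ℚ] a))
        ((BettiUniverse.pull g 1).baseChange ℂ ((1 : ℂ) ⊗ₜ[ℚ] b)) =
      ofRat (BettiUniverse.cup Y 1 1 (BettiUniverse.pull f 1 a) (BettiUniverse.pull g 1 b)) := by
  rw [LinearMap.baseChange_tmul, LinearMap.baseChange_tmul, LinearMap.BilinMap.baseChange_tmul,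
    mul_one]
  rfl

/-- **The Künneth–Casimir class of a Riemann-type pairing is a Hodge class.** Let `X/ℂ` be smooth
projective, `E` a nondegenerate bilinear form on `H¹(X(ℂ); ℚ)` whose complexification kills
`F¹H¹ × F¹H¹` (the Riemann condition: `E` is "of type `(1,1)`"), `v` a basis of `H¹(X(ℂ); ℚ)` and
`u` its `E`-dual basis (`E (u_i) (v_j) = δ_{ij}`). Then the class
`ℓ_E := Σ_i fst^* u_i ∪ snd^* v_i ∈ H²((X × X)(ℂ); ℚ)` is a Hodge class (`1 ⊗ ℓ_E ∈ F¹`). -/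
theorem casimirClass_mem_hodgeClasses (hHD : exists_isReal_hodgeModel)
    (hI : hodgePQ_independent_of_hodgeModel) (hX : IsSmoothProjective n X)
    (E : LinearMap.BilinForm ℚ (bettiCohomology X 1)) (hE : E.Nondegenerate)
    (hRiem : ∀ x ∈ (BettiUniverse.hodge hHD hX 1).F 1, ∀ y ∈ (BettiUniverse.hodge hHD hX 1).F 1,
      E.baseChange ℂ x y = 0)
    {ι : Type*} [DecidableEq ι] [Fintype ι] (v : Basis ι ℚ (bettiCohomology X 1)) :
    (∑ i, BettiUniverse.cup (X ⊗ X) 1 1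
        (BettiUniverse.pull (CartesianMonoidalCategory.fst X X) 1 (E.dualBasis hE v i))
        (BettiUniverse.pull (CartesianMonoidalCategory.snd X X) 1 (v i))) ∈
      (BettiUniverse.hodge hHD (IsSmoothProjective.tensor_holds hX hX) 2).hodgeClasses 1 := by
  classical
  haveI : FiniteDimensional ℚ (bettiCohomology X 1) := BettiUniverse.finite hX 1
  set hXX := IsSmoothProjective.tensor_holds hX hX with hXX_def
  -- the complexified data
  let W := ℂ ⊗[ℚ] bettiCohomology X 1
  let EC : LinearMap.BilinForm ℂ W := E.baseChange ℂ
  have hEC : EC.Nondegenerate := nondegenerate_baseChange E hE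
  let pr₁ : W →ₗ[ℂ] ℂ ⊗[ℚ] bettiCohomology (X ⊗ X) 1 :=
    (BettiUniverse.pull (CartesianMonoidalCategory.fst X X) 1).baseChange ℂ
  let pr₂ : W →ₗ[ℂ] ℂ ⊗[ℚ] bettiCohomology (X ⊗ X) 1 :=
    (BettiUniverse.pull (CartesianMonoidalCategory.snd X X) 1).baseChange ℂ
  let cupC := LinearMap.BilinMap.baseChange ℂ (BettiUniverse.cup (X ⊗ X) 1 1)
  let c : W →ₗ[ℂ] W →ₗ[ℂ] ℂ ⊗[ℚ] bettiCohomology (X ⊗ X) (1 + 1) := cupC.compl₁₂ pr₁ pr₂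
  have hc : ∀ x y, c x y = cupC (pr₁ x) (pr₂ y) := fun x y ↦ rfl
  let P : Submodule ℂ W := (BettiUniverse.hodge hHD hX 1).F 1
  let N : Submodule ℂ (ℂ ⊗[ℚ] bettiCohomology (X ⊗ X) (1 + 1)) := (BettiUniverse.hodge hHD hXX (1 + 1)).F 1
  -- `F⁰ = ⊤` on `H¹(X × X)`
  have hF0 : (BettiUniverse.hodge hHD hXX 1).F 0 = ⊤ := by
    rw [BettiUniverse.hodge_F]; exact HodgeModel.ratF_of_nonpos _ hXX 1 le_rfl
  have hpr₁ : ∀ x ∈ P, pr₁ x ∈ (BettiUniverse.hodge hHD hXX 1).F 1 := fun x hx ↦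
    BettiUniverse.pull_hodge hHD hI hXX hX _ 1 1 ⟨x, hx, rfl⟩
  have hpr₂ : ∀ y ∈ P, pr₂ y ∈ (BettiUniverse.hodge hHD hXX 1).F 1 := fun y hy ↦
    BettiUniverse.pull_hodge hHD hI hXX hX _ 1 1 ⟨y, hy, rfl⟩
  have hP : ∀ x ∈ P, ∀ y, c x y ∈ N := fun x hx y ↦ by
    rw [hc]
    have h := BettiUniverse.cup2_hodge hHD hI hXX 1 1 0 (pr₁ x) (pr₂ y) (hpr₁ x hx)
      (by rw [hF0]; exact Submodule.mem_top)
    simpa using h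
  have hP' : ∀ x, ∀ y ∈ P, c x y ∈ N := fun x y hy ↦ by
    rw [hc]
    have h := BettiUniverse.cup2_hodge hHD hI hXX 1 0 1 (pr₁ x) (pr₂ y)
      (by rw [hF0]; exact Submodule.mem_top) (hpr₂ y hy)
    simpa using h
  have hdim : finrank ℂ W ≤ finrank ℂ P + finrank ℂ P :=
    (finrank_F_one_add (BettiUniverse.hodge hHD hX 1)).symm.le
  -- the Casimir lemma, for the base-changed basis
  let vC : Basis ι ℂ W := Algebra.TensorProduct.basis ℂ v
  have hvC : ∀ i, vC i = 1 ⊗ₜ v i := Algebra.TensorProduct.basis_apply v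
  have key := sum_dualBasis_mem EC hEC P P hRiem hdim c N hP hP' vC
  -- identify the dual basis of `vC` with the base change of the dual basis of `v`
  have hdual : ⇑(EC.dualBasis hEC vC) = fun i ↦ ((1 : ℂ) ⊗ₜ[ℚ] E.dualBasis hE v i : W) := by
    rw [LinearMap.BilinForm.dualBasis_eq_iff]
    intro i j
    rw [hvC, LinearMap.BilinForm.baseChange_tmul, LinearMap.BilinForm.apply_dualBasis_left, mul_one]
    split_ifs <;> simp
  rw [hdual] at key
  -- and read the sum back in `ℚ`-coefficients
  rw [HodgeStructure.mem_hodgeClasses_iff, map_sum]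
  convert key using 1
  refine Finset.sum_congr rfl fun i _ ↦ ?_
  rw [hc, hvC]
  exact (baseChange_cup_pull_tmul _ _ _ _).symm

/-- **The Künneth–Casimir class of a Riemann-type pairing is algebraic** (Lefschetz `(1,1)` on
`X × X`, the tree's `lefschetzOneOne_rational_holds` via `hodgeClasses_one_le_ratAlgebraicClasses`):
under the hypotheses of `casimirClass_mem_hodgeClasses`,
`ℓ_E = Σ_i fst^* u_i ∪ snd^* v_i ∈ ratAlgebraicClasses (X × X) 1`. This is input K-b′ of row M22
(`Fact_algDuality`, clause (i)): with `E` the Rosati-balanced Riemann form of `P = ∏ A_{Φᵢ}` it is the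
Poincaré class `m^*θ - pr₁^*θ - pr₂^*θ`, obtained here without the multiplication map. -/
theorem casimirClass_mem_ratAlgebraicClasses (hHD : exists_isReal_hodgeModel)
    (hI : hodgePQ_independent_of_hodgeModel) (hX : IsSmoothProjective n X)
    (E : LinearMap.BilinForm ℚ (bettiCohomology X 1)) (hE : E.Nondegenerate)
    (hRiem : ∀ x ∈ (BettiUniverse.hodge hHD hX 1).F 1, ∀ y ∈ (BettiUniverse.hodge hHD hX 1).F 1,
      E.baseChange ℂ x y = 0)
    {ι : Type*} [DecidableEq ι] [Fintype ι] (v : Basis ι ℚ (bettiCohomology X 1)) :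
    (∑ i, BettiUniverse.cup (X ⊗ X) 1 1
        (BettiUniverse.pull (CartesianMonoidalCategory.fst X X) 1 (E.dualBasis hE v i))
        (BettiUniverse.pull (CartesianMonoidalCategory.snd X X) 1 (v i))) ∈
      ratAlgebraicClasses (X ⊗ X) 1 :=
  hodgeClasses_one_le_ratAlgebraicClasses hHD hI (IsSmoothProjective.tensor_holds hX hX)
    (casimirClass_mem_hodgeClasses hHD hI hX E hE hRiem v)

end Hodge

end Summit.HodgeConjecture.CorCM.Model

end
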